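import Literature.NumberTheory.GaloisCohomology.CyclicClassLocalArtinSymbolDecomposition
import Literature.NumberTheory.EllipticCurves.ZpExtensionLayerCharacter
import HarnessLib

/-!
# The local symbol of a unit against the layers of the cyclotomic `ℤ_p`-extension:
# `inv_v (κ_{p^m}(u) ∪ [κ_cyc ∘ res_v mod p^m]) = -κ_cyc(σ_{N u}) mod p^m` (Kato II Lemma 1.4.5 levelwise, packaged)

`K` a number field, `κ : Γ_K ↠ ℤ_p` a CYCLOTOMIC `ℤ_p`-extension (the tree's `ZpExtension K p` with `IsCyclotomic`:
`ker κ = ε_p⁻¹(μ(ℤ_p))`; for `K = ℚ` the constructed `CyclotomicZp.zpExtension p`, `κ_cyc = ℓ ∘ χ_p`), `v ∣ p` a finite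
place, `u ∈ 𝒪_vˣ`, `σ ∈ Γ_K` with `ε_p(σ) = N_{K_v/ℚ_p}(u)` in `ℚ_p`, and `c : Γ_{K_v} → μ_{p^m}^∨(1)` any continuous crossed
homomorphism representing the `m`-th layer character restricted to the decomposition group,
`c(τ)(x) = (κ(res_v τ) mod p^m)·x`.  Then THE residue map of `K_v` gives

  `inv_{p^m} (κ_{p^m}(u) ∪ [c]) = -(κ(σ) mod p^m)`            (`invLevel_cupProduct_δ₀_eq_neg_toZModPow_of_isCyclotomic`).

This is part IV's `invLevel_cupProduct_δ₀_eq_neg_apply_of_cyclotomicCharacter_eq_norm_of_forall_apply` with the layer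
character `ψ_m = κ mod p^m` (`ZpExtension.exists_cyclicCharacter_layer`: `ker ψ_m = Gal(K̄/K_m)`, `K_m/K` finite abelian)
— which factors through `ε_p` because `ε_p σ = ε_p τ ⇒ στ⁻¹ ∈ ε_p⁻¹(1) ⊆ ker κ`.  With `κ = ℓ ∘ ε_p`
(`ℓ = log_p / log_p γ_cyc`) it reads `inv(κ_{p^m}(u) ∪ log χ_cyclo-layer) ≡ -ℓ(N_{K_v/ℚ_p} u) = -Tr_{K_v/ℚ_p}(log_p u)/log_p γ_cyc`:
Kato's Lemma 1.4.5 (`⟨exp(a), log χ_cyclo⟩ = -Tr(a)`), levelwise at a completion, up to the normalising unit — floor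
(d) of the [REC] programme of crux K★ `stmt-BirchSwinnertonDyer-22226` (memo
`Summits/…/Cruxes/StarredOptimalManinUnitFiveSeven/Lines/kato-lever-K3-floor-d.md`).

Proof file: one theorem (no definition, no named fact, no instance; D-0026).  HONEST FRAMING: textbook local class field
theory; K★ / BSD are not proved by any of this.

## References

* K. Kato, LNM 1553 (1993), Ch. II 1.4.2, Lemma 1.4.5. [Kato1993LNM1553]
* J.-P. Serre, *Local Fields* (1979), XIV §1 Prop. 3. [SerreLocalFields1979]
* L. Washington, *Introduction to Cyclotomic Fields* (1997), §13.1 (layers of a `ℤ_p`-extension). [Washington1997]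
-/

noncomputable section

open CategoryTheory Function NumberField IsDedekindDomain Field ValuativeRel
open scoped NumberField

namespace Literature.NumberTheory.GaloisCohomology

open _root_.ContinuousCohomology
open Literature.NumberTheory.GaloisRepresentations
open Literature.NumberTheory.GaloisRepresentations.DiscreteGaloisModule
open Literature.NumberTheory.GaloisRepresentations.LocalWeilDatum
open Literature.NumberTheory.GaloisRepresentations.IsNonarchimedeanLocalField
open Literature.NumberTheory.NumberFields
open Literature.NumberTheory.EllipticCurves
open Literature.AnabelianGeometry.AbsoluteAnabelian
open Literature.AnabelianGeometry.AbsoluteAnabelian.Prop121vii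

variable {K : Type} [Field K] [NumberField K] {p : ℕ} [hp : Fact p.Prime]

/-- **Kato II Lemma 1.4.5 levelwise at `v ∣ p`, for the cyclotomic `ℤ_p`-extension.**  `κ : Γ_K ↠ ℤ_p` cyclotomic
(`ker κ = ε_p⁻¹(μ(ℤ_p))`), `v ∣ p` (`|p|_v < 1`), `u ∈ 𝒪_vˣ` (`|u|_v = 1`), `σ ∈ Γ_K` with `ε_p(σ) = N_{K_v/ℚ_p}(u)` in `ℚ_p`
(canonical `ℚ_p`-structure of `K_v`), `c : Γ_{K_v} → μ_{p^m}^∨(1)` any continuous crossed homomorphism with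
`c(τ)(x) = (κ(res_v τ) mod p^m)·x`.  Then `inv_{p^m} (κ_{p^m}(u) ∪ [c]) = -(κ(σ) mod p^m)` in `ℤ/p^m` — the local symbol
of a unit against the `m`-th cyclotomic layer is read off its norm to `ℚ_p`.
[cite: Kato1993LNM1553, Ch. II Lemma 1.4.5] [cite: SerreLocalFields1979, XIV §1 Prop. 3] [cite: Washington1997, §13.1] -/
theorem invLevel_cupProduct_δ₀_eq_neg_toZModPow_of_isCyclotomic
    (κ : ZpExtension K p) (hκ : κ.IsCyclotomic) (m : ℕ) (v : HeightOneSpectrum (𝓞 K))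
    (hpv : valuation (v.adicCompletion K) (p : v.adicCompletion K) < 1)
    (c : haveI : NeZero (p ^ m) := ⟨pow_ne_zero m hp.out.ne_zero⟩
      contOneCocycles ((mu (v.adicCompletion K) (p ^ m)).tateDual (p ^ m)).toTopRep)
    (hc : haveI : NeZero (p ^ m) := ⟨pow_ne_zero m hp.out.ne_zero⟩
      ∀ (τ : absoluteGaloisGroup (v.adicCompletion K)) (x : MuCarrier (v.adicCompletion K) (p ^ m)),
        c.1 τ x = (((PadicInt.toZModPow m
          (Multiplicative.toAdd (κ (absGaloisRestrict K (v.adicCompletion K) τ)))).val : ℤ)) • x)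
    (u : v.adicCompletion K) (hu : u ≠ 0) (hu1 : valuation (v.adicCompletion K) u = 1)
    (σ : absoluteGaloisGroup K)
    (hσ : haveI : CharZero (v.adicCompletion K) := charZero_adicCompletion v
      letI := LocalField.padicAlgebra (v.adicCompletion K) p hpv
      (((GaloisRep.cyclotomicCharacter K p σ : ℤ_[p]ˣ) : ℤ_[p]) : ℚ_[p]) = Algebra.norm ℚ_[p] u) :
    haveI : NeZero (p ^ m) := ⟨pow_ne_zero m hp.out.ne_zero⟩
    haveI : CompactSpace (absoluteGaloisGroup (v.adicCompletion K)) := absoluteGaloisGroup_compactSpace _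
    haveI : CharZero (v.adicCompletion K) := charZero_adicCompletion v
    invLevel (v.adicCompletion K) (p ^ m) (((mu (v.adicCompletion K) (p ^ m)).tateDualPairing (p ^ m)).cupProduct
        ((isSES_kummer (v.adicCompletion K) (p ^ m) (NeZero.pos (p ^ m))).δ₀
          (baseUnitsInvariant (v.adicCompletion K) u hu))
        (oneCocycleClass _ c)) =
      -PadicInt.toZModPow m (Multiplicative.toAdd (κ σ)) := by
  haveI : NeZero (p ^ m) := ⟨pow_ne_zero m hp.out.ne_zero⟩
  haveI : CompactSpace (absoluteGaloisGroup (v.adicCompletion K)) := absoluteGaloisGroup_compactSpace _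
  haveI : CharZero (v.adicCompletion K) := charZero_adicCompletion v
  -- the layer character `ψ = κ mod p^m` and its field `K_m`
  obtain ⟨ψ, -, hker, hψ⟩ := κ.exists_cyclicCharacter_layer m
  haveI : FiniteDimensional K (κ.layer m) := κ.finiteDimensional_layer_holds m
  haveI : IsAbelianGalois K (κ.layer m) := κ.isAbelianGalois_layer m
  haveI : NumberField (κ.layer m) := NumberField.of_module_finite K (κ.layer m)
  -- `ψ` factors through `ε_p`
  have hψε : ∀ σ₁ σ₂ : absoluteGaloisGroup K,
      GaloisRep.cyclotomicCharacter K p σ₁ = GaloisRep.cyclotomicCharacter K p σ₂ → ψ σ₁ = ψ σ₂ := by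
    intro σ₁ σ₂ h
    have hmem : σ₁ * σ₂⁻¹ ∈ κ.kerSubgroup := by
      rw [show κ.kerSubgroup = _ from hκ, Subgroup.mem_comap]
      change GaloisRep.cyclotomicCharacter K p (σ₁ * σ₂⁻¹) ∈ CommGroup.torsion ℤ_[p]ˣ
      rw [map_mul, map_inv, h, mul_inv_cancel]
      exact one_mem _
    rw [ZpExtension.mem_kerSubgroup, map_mul, map_inv, mul_inv_eq_one] at hmem
    rw [hψ, hψ, hmem]
  have hc' : ∀ (τ : absoluteGaloisGroup (v.adicCompletion K)) (x : MuCarrier (v.adicCompletion K) (p ^ m)),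
      c.1 τ x = (((ψ (absGaloisRestrict K (v.adicCompletion K) τ)).val : ℤ)) • x := fun τ x => by
    rw [hc, hψ]
  rw [invLevel_cupProduct_δ₀_eq_neg_apply_of_cyclotomicCharacter_eq_norm_of_forall_apply (κ.layer m) v p hpv ψ
    hker hψε c hc' u hu hu1 σ hσ, hψ]

end Literature.NumberTheory.GaloisCohomology

end
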